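import Summits.CriticalPhenomena.CardyFormulaZ2.Theorems.CardyIKTransportCornerLineDescentRoutePosition
import Summits.CriticalPhenomena.CardyFormulaZ2.Theorems.CardyIKTransportCornerLineDescentLine
import Summits.CriticalPhenomena.CardyFormulaZ2.Theorems.CardyAnchoredRigiditySubseqCardyStubCountableApproxBondNearCrude
import Summits.CriticalPhenomena.CardyFormulaZ2.Theorems.CardyMeckeFlipLawToCrossings

/-!
# The crux `CardyIKTransport.CornerLineDescent` (stmt-CriticalPhenomena-10964) is SUMMIT-STRENGTH:
# a corollary of the conjunct, and equivalent to it under the sibling crux `CardyIK`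

Support file (`--supports stmt-CriticalPhenomena-10964`; redirect strategist r1, 2026-08-17), written for the
tribunal that is to close the crux (D-0033 T1).  The crux is `CornerLineDescent ↔ (CardyIK → CrudeBondCardy)`
(`Iff.rfl`), where `CrudeBondCardy = ∀ R, R.HasCrossingLimit (bondStdCrossingProb R) cardyFunction` is Cardy's formula
for bond-`ℤ²` at `p = ½` in the CRUDE standard-embedding crossing event.  The tree already has
`CrudeBondCardy → CardyFormulaZ2` (`crudeToCanonical_proof`, item 4968) and, given the route's other open crux r2,
`CornerLineDescent ↔ CrudeBondCardy` (`cornerLineDescent_iff_crudeBondCardy_of_ikLinearTransport`).  What was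
missing for a two-sided certificate is the converse comparison **canonical ⇒ crude**, which is three lines over
the landed sandwich `stub_bondNearCrude` (`|G02(δ) − crude(δ/√2)| ≤ ε` eventually; Schramm–Smirnov (5.1) +
Bollobás–Riordan Ch. 7 Claim 19, PROVED in the tree).  Consequences, kernel-checked here (all types written as
explicit implications; nothing below closes the item):

* `crudeBondCardy_of_cardyFormulaZ2`, `crudeBondCardy_iff_cardyFormulaZ2` — the crude and the canonical (G02)
  forms of the sub-problem are EQUIVALENT;
* `cornerLineDescent_of_cardyFormulaZ2` — **S → C**: the crux is a COROLLARY of the conjunct (so a refutation of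
  the crux would refute `CardyFormulaZ2` itself: the crux is exactly as unfalsifiable as the summit);
* `cornerLineDescent_iff_cardyFormulaZ2_of_cardyIK` — **under the sibling crux `CardyDiluteOrbit.CardyIK`
  (stmt-5913) the crux IS the sub-problem statement**: `CardyIK → (CornerLineDescent ↔ CardyFormulaZ2)`;
* `cornerLineDescent_iff_cardyFormulaZ2_of_ikLinearTransport` — the same with `CardyIK` discharged from the
  route's r2 `IKLinearTransport` (stmt-5076) via `cardyIK_of_ikLinearTransport`: **inside route
  `CardyIKTransport`, closing r3 = closing `CardyFormulaZ2`**;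
* `cornerLineDescent_and_cardyIK_iff` — `CornerLineDescent ∧ CardyIK ↔ CardyFormulaZ2 ∧ CardyIK`;
* `ikBondBridge_iff_cardyFormulaZ2_of_cardyIK` — the sibling o(1)-bridge `IKBondBridge` (stmt-5914) sits in the
  same position.

T1 reading: the dominating hypothesis `H := CardyFormulaZ2` gives C (`cornerLineDescent_of_cardyFormulaZ2`) and S
alone; the certified direction `C → S` holds exactly modulo `CardyIK` and its converse `S → C` is now known; the
only separating witness between C and S would be `¬ CardyIK` (numerically excluded: crux Disproof §E, 2:1 crossing
`0.1758 ± 0.0012` vs Cardy `0.17565`).  No new mathematics: plumbing over landed theorems.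
References: `Theses/CardyIKTransport.lean` (item L433, `closes`);
`Theorems/CardyIKTransportCornerLineDescentRoutePosition.lean`;
`Theorems/CardyAnchoredRigiditySubseqCardyStubCountableApproxBondNearCrude.lean` (`stub_bondNearCrude`);
O. Schramm, S. Smirnov, Ann. Probab. 39 (2011) 1768–1814, Lemma 5.1; B. Bollobás, O. Riordan, *Percolation*
(CUP 2006) Ch. 7 Claim 19.
-/

noncomputable section

namespace Summit.CriticalPhenomena.CardyFormulaZ2.Theorems.CornerLineDescent

open Filter Topology
open Literature.Probability.RandomPlanarGeometry
open Literature.Probability.Percolation (bondDomainCrossingProb)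
open Summit.CriticalPhenomena.CardyFormulaZ2.Theses
open Summit.CriticalPhenomena.CardyFormulaZ2.Theorems.CornerLineDescent.SymmetricSeed (bondStdCrossingProb)
open Summit.CriticalPhenomena.CardyFormulaZ2.Cruxes.SubseqCardy.Birth (stub_bondNearCrude)
open Summit.CriticalPhenomena.CardyFormulaZ2.Theorems.MeckeFlipBridge (tendsto_mul_sqrt_two)

/-- The crux by name is `CardyIK → (crude standard bond-ℤ² Cardy in every conformal rectangle)` (`Iff.rfl`).
[folklore] -/
theorem cornerLineDescent_iff_cardyIK_imp :
    CardyIKTransport.CornerLineDescent ↔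
      (CardyDiluteOrbit.CardyIK →
        ∀ R : ConformalRectangle, R.HasCrossingLimit (bondStdCrossingProb R) cardyFunction) :=
  Iff.rfl

/-- **Canonical limits are crude limits (at crude mesh `δ/√2`)**: if `bondDomainCrossingProb R δ → L` then
`bondStdCrossingProb R (δ/√2) → L`, by the landed sandwich `stub_bondNearCrude`
(`|G02(δ) − crude(δ/√2)| ≤ ε` eventually, every `ε > 0`). [cite: SchrammSmirnov2011, Lemma 5.1 and eq. (5.1)] -/
theorem tendsto_crude_of_tendsto_bond (R : ConformalRectangle) {L : ℝ} :
    Tendsto (bondDomainCrossingProb R) (𝓝[>] 0) (𝓝 L) →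
      Tendsto (fun δ => bondStdCrossingProb R (δ / Real.sqrt 2)) (𝓝[>] 0) (𝓝 L) := by
  intro h
  have hdiff : Tendsto (fun δ => bondDomainCrossingProb R δ - bondStdCrossingProb R (δ / Real.sqrt 2))
      (𝓝[>] 0) (𝓝 0) := by
    rw [Metric.tendsto_nhds]
    intro ε hε
    filter_upwards [stub_bondNearCrude R (ε / 2) (half_pos hε)] with δ hδ
    have hδ' : |bondDomainCrossingProb R δ - bondStdCrossingProb R (δ / Real.sqrt 2)| ≤ ε / 2 := hδ
    rw [Real.dist_0_eq_abs]
    linarith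
  have h2 : Tendsto (fun δ => bondDomainCrossingProb R δ -
      (bondDomainCrossingProb R δ - bondStdCrossingProb R (δ / Real.sqrt 2))) (𝓝[>] 0) (𝓝 (L - 0)) :=
    h.sub hdiff
  simp only [sub_sub_cancel, sub_zero] at h2
  exact h2

/-- **Canonical ⇒ crude**: Cardy's formula for G02's `bondDomainCrossingProb` in every conformal rectangle
(`CardyFormulaZ2`) implies Cardy's formula for the crude standard-embedding event in every conformal rectangle —
the converse of the route's proved support item `CrudeToCanonical` (stmt-4968).
[cite: SchrammSmirnov2011, Lemma 5.1] [cite: BollobasRiordan2006, Ch. 7 Claim 19 p. 192] -/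
theorem crudeBondCardy_of_cardyFormulaZ2 :
    _root_.CardyFormulaZ2 →
      ∀ R : ConformalRectangle, R.HasCrossingLimit (bondStdCrossingProb R) cardyFunction := by
  intro hS R φ x hφx
  have h1 := tendsto_crude_of_tendsto_bond R (hS R φ x hφx)
  have h2 := h1.comp tendsto_mul_sqrt_two
  refine h2.congr' (Eventually.of_forall fun δ => ?_)
  show bondStdCrossingProb R (δ * Real.sqrt 2 / Real.sqrt 2) = bondStdCrossingProb R δ
  rw [mul_div_assoc, div_self (Real.sqrt_ne_zero'.2 two_pos), mul_one]

/-- **The crude and canonical forms of the sub-problem are equivalent** (`→`: item 4968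
`crudeToCanonical_proof`; `←`: `crudeBondCardy_of_cardyFormulaZ2`). [folklore] -/
theorem crudeBondCardy_iff_cardyFormulaZ2 :
    (∀ R : ConformalRectangle, R.HasCrossingLimit (bondStdCrossingProb R) cardyFunction) ↔
      _root_.CardyFormulaZ2 :=
  ⟨fun h => crudeToCanonical_proof h, crudeBondCardy_of_cardyFormulaZ2⟩

/-- **S → C: the crux is a corollary of the conjunct** — `CardyFormulaZ2 → CornerLineDescent` (the hypothesis
`CardyIK` is not used).  Hence `¬ CornerLineDescent → ¬ CardyFormulaZ2`: any refutation of the crux refutes the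
sub-problem. [folklore] -/
theorem cornerLineDescent_of_cardyFormulaZ2 :
    _root_.CardyFormulaZ2 → CardyIKTransport.CornerLineDescent :=
  fun hS _ => crudeBondCardy_of_cardyFormulaZ2 hS

/-- **Under the sibling crux `CardyIK` (stmt-5913) the crux IS the sub-problem**:
`CardyIK → (CornerLineDescent ↔ CardyFormulaZ2)`. [folklore] -/
theorem cornerLineDescent_iff_cardyFormulaZ2_of_cardyIK : Summit.CriticalPhenomena.CardyFormulaZ2.Theses.CardyDiluteOrbit.CardyIK → (Summit.CriticalPhenomena.CardyFormulaZ2.Theses.CardyIKTransport.CornerLineDescent ↔ _root_.CardyFormulaZ2) :=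
  fun hIK => ⟨fun h => crudeToCanonical_proof (h hIK), cornerLineDescent_of_cardyFormulaZ2⟩

/-- **Inside the route: given r2 `IKLinearTransport` (stmt-5076), closing r3 is closing the conjunct** —
`IKLinearTransport → (CornerLineDescent ↔ CardyFormulaZ2)` (`CardyIK` discharged by
`cardyIK_of_ikLinearTransport`: Smirnov + quarter turn + two-ended rigidity, all proved). [folklore] -/
theorem cornerLineDescent_iff_cardyFormulaZ2_of_ikLinearTransport :
    CardyIKTransport.IKLinearTransport → (CardyIKTransport.CornerLineDescent ↔ _root_.CardyFormulaZ2) :=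
  fun hlin => cornerLineDescent_iff_cardyFormulaZ2_of_cardyIK (cardyIK_of_ikLinearTransport hlin)

/-- Conjunction form for the funnel: `CornerLineDescent ∧ CardyIK ↔ CardyFormulaZ2 ∧ CardyIK` — the pair
(this crux, sibling crux 5913) carries exactly the conjunct plus the IK anchor. [folklore] -/
theorem cornerLineDescent_and_cardyIK_iff :
    (CardyIKTransport.CornerLineDescent ∧ CardyDiluteOrbit.CardyIK) ↔
      (_root_.CardyFormulaZ2 ∧ CardyDiluteOrbit.CardyIK) :=
  ⟨fun h => ⟨(cornerLineDescent_iff_cardyFormulaZ2_of_cardyIK h.2).1 h.1, h.2⟩,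
    fun h => ⟨cornerLineDescent_of_cardyFormulaZ2 h.1, h.2⟩⟩

/-- The o(1)-bridge sibling `IKBondBridge` (stmt-5914) sits in the same position: under `CardyIK` all three of
`CornerLineDescent`, `IKBondBridge`, `CardyFormulaZ2` are equivalent. [folklore] -/
theorem ikBondBridge_iff_cardyFormulaZ2_of_cardyIK :
    CardyDiluteOrbit.CardyIK → (CardyDiluteOrbit.IKBondBridge ↔ _root_.CardyFormulaZ2) :=
  fun hIK => (cornerLineDescent_iff_ikBondBridge_of_cardyIK hIK).symm.trans
    (cornerLineDescent_iff_cardyFormulaZ2_of_cardyIK hIK)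

end Summit.CriticalPhenomena.CardyFormulaZ2.Theorems.CornerLineDescent
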